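import Summits.QuantumFields.YangMills.Theorems.BalabanUVNodesN21AtRRec12ConstLayer
import Summits.QuantumFields.YangMills.Theorems.BalabanUVNodesN21EndLettersDefs
import Summits.QuantumFields.YangMills.Theorems.BalabanUVNodesRateReadingOfRecord12

/-!
# YM-DAG node N21 (= NE7c) — THE COMPOSITE KNIT AT THE STAGE-12 HOMES READ AT THE RATE READING OF RECORD `YMDAG.UVSplit.readingOfRecord₁₂ w1 ℓ₃ ne2 ne1`
# (dag-n22-e, edition 1): module 10's `spine_rec12C_of_homes₁₂_constLayer` with the NE3 pin DISCHARGED BY `rfl` (`readingOfRecord₁₂_ne3`: N16's layer IS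
# node00-def-RR-1's constant layer of record `ne3ConstLayerOfRecord₁₁ F N (ℓ₃ F)`), and — at THE END's letters TUNED FOR N21 (`endLettersN21`, module 11a) — with THE
# END's proviso and N21's two numerals DISCHARGED as well: the N21 slot then costs ONLY NODE O's term-object readings `hread`, and (dag-n16-e's closer by name) the
# N16 slot only `LeafSlot` at the tuned object

Track A of `YM-PLAN.md` (cell `pub-ymgap`, HUMAN RULING D-0062), node **N21**; R134 fan-out seat `pub-ymgap-dag-n21-d` (s2 = BY-NAME KNIT at the record), generation 3,
module 11b.  THEOREMS ONLY: 0 `def`, 0 `sorry`, standard axioms; COUNT-NEUTRAL; `--supports` the K3′ item `SpineGivenEndpointR12` (rev 15, stmt-QuantumFields-19908) as a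
helper.  `N`-generic, NO Theses import (restate-immune).  Imports module 10 `BalabanUVNodesN21AtRRec12ConstLayer` (p469867), module 11a `BalabanUVNodesN21EndLettersDefs`
(p471025: `endLettersN21`, `inEndRegime_ofRecord_endLettersN21`, `numeral_endLettersN21`), dag-n22-e's `BalabanUVNodesRateReadingOfRecord12` (`readingOfRecord₁₂`, faces
`rfl`) and, through 11a, dag-n16-e's `BalabanUVNodesN16AtRRec12OfRecord` (`s_N16_rRec₁₂_ofRecord_of_leafSlot`).  Restates nothing; cites by name.  (The explicit-carrier
faces at the reading of record are module 10 §2's `shellWeightBound_geometric_of_rRec₁₂_ofRecord_inEndRegime ∕ _u2Output` applied with `hconst := fun … ↦ rfl` — pure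
specialisations, not re-stated here per the gate's dedup rule.)

WHAT IS PROVED ([bookkeeping]; each step ONE application BY NAME, the NE3 pin `rfl`).
* `spine_rec12C_of_homes₁₂_readingOfRecord₁₂` (generic letters `ℓ₃`): dag-n27-c XXVII's composite — six K4 stubs AT THE READING OF RECORD, `S_N27x`, `S_N20` at
  `SRec₁₂ cr`, the home-keyed N19′ edge — with the N21 slot supplied by THE END's proviso at RR-1's object, the two numerals and NODE O's term-object readings `hread`
  (module 10 §4, NE3 pin `rfl`).  Conclusion `Spine ₁₂C`.
* `spine_rec12C_of_homes₁₂_readingOfRecord₁₂_tuned` (letters `ℓ₃ F := endLettersN21 F N (g F) (Λ F)`, `0 < g F`, `0 < Λ F`): proviso and numerals DISCHARGED (module 11a)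
  — THE N21 SLOT COSTS ONLY `hread`.
* `spine_rec12C_of_homes₁₂_readingOfRecord₁₂_tuned_of_leafSlot`: moreover `h16 : S_N16 (RRec₁₂ (readingOfRecord₁₂ …))` SUPPLIED by dag-n16-e's
  `s_N16_rRec₁₂_ofRecord_of_leafSlot` from `LeafSlot` at the tuned object of every family carrying a datum of record (its proviso 11a's): in K3′'s composite at the
  homes, N16 ↦ `LeafSlot`, N21 ↦ `hread`; the other stubs and the edge as displayed.

HONEST FRAMING (binding).  `S_N1x (RRec₁₂ ·)`, `S_N27x`, `S_N20`, the N19′ edge, `LeafSlot` (N05's leaf clauses ∘ N07's `LeafH3sup`), the ledgers ((M1) NOT PRINTED +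
[dict], incl. the (0.4)∕(42) averaging transfer — GAP-STATED of record), live windows, `D̄`, threshold widths and the [dict] clauses inside `hread` are HYPOTHESES, displayed;
`w1` (W1's towers: residual DATA), `ne2`, `ne1`, `cr` are PARAMETERS (no reading of Bałaban's dressed two-run expansion exists in the tree); the tuned letters are a CHOICE
inside THE END's displayed tolerance; no inhabitant of `IsDatumOfRecord₁₂C` claimed (K0′ open); nothing of Bałaban's asserted; NE3 ∕ NE7 ∕ NE7b ∕ NE7c NOT PRINTED for d = 4
and NOT PROVED; **N21 NOT discharged**, N16 ∕ N27 NOT discharged, K3′ NOT claimed; typed 28∕28, discharged count untouched; one finite four-torus programme at fixed `ε` — NOT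
ℝ⁴, NOT infinite volume, NOT OS, NOT a mass gap, NOT Clay.  No decl below carries a cite tag.
v1.1 (generation 4, APPEND-ONLY: every v1.0 declaration byte-identical) — §4 THE COMPOSITE AT WINDOWED LETTERS.  dag-n16-e g4's located item «ε PINNED AT THE TOP OF THE
TOLERANCE» (pub-ymgap INBOX DAGN16E-G4-LOCATED-3): §2∕§3 below pin `ℓ₃ := endLettersN21` (`ε = Λ₁ = r`), at which N16's `LeafSlot` hypothesis of §3 is not certifiably
inhabitable ([B8] Thm 4's averaging window forces `c.ε < c2' 4 c.L ∕ 2`).  §4 re-reads §1 (ℓ₃-generic, unaffected) at module 11a v1.1's WINDOWED letters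
`ℓ₃ F := endLettersN21W F N (g F) (ε F) (Λ₁ F) (Λ F)` — class radius `0 < ε F ≤ r_F` and gradient letter `0 ≤ Λ₁ F ≤ r_F` DISPLAYED, free to be taken inside N05's window
(n16-e's recipe `…N16SlotWindow.leafSlot_ofRecord_of_window`): `…_window` (N21 ↦ `hread` only) and `…_window_of_leafSlot` (N16 ↦ `LeafSlot` at the windowed layer).
-/

set_option autoImplicit false

noncomputable section

open scoped BigOperators Matrix Matrix.Norms.L2Operator

namespace Summit.QuantumFields.YangMills.Theorems.N21AtReadingOfRecord12

open Literature.MathematicalPhysics.QuantumFieldTheory.Balaban1983to89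
open Literature.MathematicalPhysics.QuantumFieldTheory.Balaban1983to89.T4Continuum (T4Family ULoop)
open B7Prop1Explicit B7Prop2Explicit
open T4AveragingDeficitWall (Plane)
open T4WeightBudget (RelWeightBound)
open T4IndicatorShell (ShellWeightBound)
open T4ShellMeasureLevels (LevelLedger LiveWindow)
open Summit.QuantumFields.BalabanUV.T4Continuum
open Summit.QuantumFields.BalabanUV.T4Continuum.Spine
open MinimalActionSandwich (IsMinimiser)
open MinimalActionRate (Regular sfClass)
open MinimalActionRefine (RegularSup)
open YMDAG.UVSplit
open Summit.QuantumFields.YangMills.BalabanUVNodes.N16Regime (InEndRegime)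
open Summit.QuantumFields.YangMills.BalabanUVNodes.N16LeafSlot (LeafSlot)
open Summit.QuantumFields.YangMills.BalabanUVNodes.N16AtRRec12OfRecord (s_N16_rRec₁₂_ofRecord_of_leafSlot)
open Summit.QuantumFields.YangMills.BalabanUVNodes.N21EndLetters (endLettersN21 inEndRegime_ofRecord_endLettersN21 numeral_endLettersN21
  endLettersN21W inEndRegime_ofRecord_endLettersN21W numeral_endLettersN21W)
open N21AtRRec12ConstLayer (spine_rec12C_of_homes₁₂_constLayer)
open Node00 (NE3Letters₁₁ NE2Objects₁₁ Stage12Params IsDatumOfRecord₁₂C IsRecordOfRecord₁₂C datumOfRecord₁₂ ne3ConstLayerOfRecord₁₁)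
open Node00.W1 (ReadingData)

variable {N : ℕ} [NeZero N]
  (w1 : (F : T4Family) → (θ : Stage12Params F N) → ReadingData F (Node00.MatA N) θ.τ9.M)
  (ne2 : (F : T4Family) → Stage12Params F N → (ℕ → ℝ) → List (ULoop F) → ℕ → NE2Objects₁₁)
  (ne1 : (F : T4Family) → Stage12Params F N → (ℕ → ℝ) → List (ULoop F) → NE1pCarriers)

/-! ## The composite knit at the homes AT THE READING OF RECORD -/

section Composite

variable (cr : SpineReading₁₂ N)

/-- **N27 = B5 AT THE STAGE-12 RECORD FROM THE HOMES, THE RATE HOME READ AT THE READING OF RECORD (generic letters).**  Module 10's `spine_rec12C_of_homes₁₂_constLayer` at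
`𝔯 := readingOfRecord₁₂ w1 ℓ₃ ne2 ne1`, NE3 pin `rfl`: the six K4 stubs AT THE READING OF RECORD (dag-n22-e's faces say what each IS), `S_N27x`, `S_N20` at `SRec₁₂ cr`, the
home-keyed N19′ edge; the N21 slot supplied by THE END's proviso at RR-1's object of every family, the two numerals, and NODE O's term-object readings `hread` of the carriers
`cr F θ hP g₀ os` (module 10 §3's shape at `o F := ne3ConstLayerOfRecord₁₁ F N (ℓ₃ F)`).  Every binder a HYPOTHESIS; N21 ∕ N27 NOT discharged; K3′ NOT claimed. [bookkeeping] -/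
theorem spine_rec12C_of_homes₁₂_readingOfRecord₁₂ (ℓ₃ : T4Family → NE3Letters₁₁)
    (hreg : ∀ F : T4Family, InEndRegime (ne3OfRecord₁₁ F (ne3ConstLayerOfRecord₁₁ F N (ℓ₃ F))))
    (hnum : ∀ F : T4Family, 512 * (4 + 1) * (4 + 4) * (F.L : ℝ) ^ 2 * (ne3ConstLayerOfRecord₁₁ F N (ℓ₃ F)).b ≤ 1 ∧ 0 < (ne3ConstLayerOfRecord₁₁ F N (ℓ₃ F)).Λ₂')
    (hread : ∀ (F : T4Family) (θ : Stage12Params F N) (hP : θ.Provisos₁₂ F N), θ.Admissible F N → ∀ (g₀ : ℕ → ℝ) (os : List (ULoop F)),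
      ∃ (ε' cg : ℝ) (σA σB : Type) (SA : ℕ → Finset σA) (SB : ℕ → Finset σB) (pieceA : ℕ → ℝ → σA → (cr F θ hP g₀ os).ι → ℝ)
        (pieceB : ℕ → ℝ → σB → (cr F θ hP g₀ os).ι → ℝ) (lvlA : ℕ → σA → ℕ) (lvlB : ℕ → σB → ℕ) (DA ρA DB ρB τA τB : ℕ → ℝ) (N₁ : ℕ)
        (νbar Dbar c₂ ϑ₂ : ℝ),
        0 < ε' ∧ 0 ≤ cg ∧
        LevelLedger (cr F θ hP g₀ os).l₀ (cr F θ hP g₀ os).T (cr F θ hP g₀ os).A (cr F θ hP g₀ os).shA SA pieceA lvlA DA ρA ∧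
        LevelLedger (cr F θ hP g₀ os).l₀ (cr F θ hP g₀ os).T (cr F θ hP g₀ os).B (cr F θ hP g₀ os).shB SB pieceB lvlB DB ρB ∧
        LiveWindow SA lvlA N₁ νbar ∧ LiveWindow SB lvlB N₁ νbar ∧ (∀ j, DA j ≤ Dbar) ∧ (∀ j, DB j ≤ Dbar) ∧
        0 ≤ c₂ ∧ 0 ≤ ϑ₂ ∧ ϑ₂ < 1 ∧ (∀ j, τA j ≤ c₂ * ϑ₂ ^ j) ∧ (∀ j, τB j ≤ c₂ * ϑ₂ ^ j) ∧
        (∀ j, 1 ≤ j → ∀ x : ℝ,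
          (∀ (V UA UB : B7Prop1Explicit.Site 4 → Fin 4 → (Matrix (Fin N) (Fin N) ℂ)ˣ) (z : B7Prop1Explicit.Site 4) (μ ν : Fin 4) (t : ℝ),
            V ∈ (ne3ConstLayerOfRecord₁₁ F N (ℓ₃ F)).dom →
            IsMinimiser 4 (sfClass 4 F.L (ne3ConstLayerOfRecord₁₁ F N (ℓ₃ F)).Nper (ne3ConstLayerOfRecord₁₁ F N (ℓ₃ F)).ε) F.L
              (ne3ConstLayerOfRecord₁₁ F N (ℓ₃ F)).Nper j V UA →
            IsMinimiser 4 (sfClass 4 F.L (ne3ConstLayerOfRecord₁₁ F N (ℓ₃ F)).Nper (ne3ConstLayerOfRecord₁₁ F N (ℓ₃ F)).ε) F.L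
              (ne3ConstLayerOfRecord₁₁ F N (ℓ₃ F)).Nper (j + 1) V UB →
            Regular 4 F.L (ne3ConstLayerOfRecord₁₁ F N (ℓ₃ F)).Nper (ne3ConstLayerOfRecord₁₁ F N (ℓ₃ F)).b (ne3ConstLayerOfRecord₁₁ F N (ℓ₃ F)).g (j + 1) UB →
            ε' * ((F.L : ℝ)⁻¹) ^ (2 * j) ≤ t →
            |‖((hol UA z (plaqWord μ ν) : (Matrix (Fin N) (Fin N) ℂ)ˣ) : Matrix (Fin N) (Fin N) ℂ) - 1‖
                - ‖((hol (rescale F.L (bavg F.L UB)) z (plaqWord μ ν) : (Matrix (Fin N) (Fin N) ℂ)ˣ) : Matrix (Fin N) (Fin N) ℂ) - 1‖| / t ≤ x) →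
          ρA j ≤ x + τA j) ∧
        (∀ j, 1 ≤ j → ∀ x : ℝ,
          (∀ (V UA UB : B7Prop1Explicit.Site 4 → Fin 4 → (Matrix (Fin N) (Fin N) ℂ)ˣ) (z : B7Prop1Explicit.Site 4) (π : Plane 4)
            (r₀ : Fin 4 → Fin F.L) (i₀ j₀ : ℕ) (t : ℝ),
            V ∈ (ne3ConstLayerOfRecord₁₁ F N (ℓ₃ F)).dom →
            IsMinimiser 4 (sfClass 4 F.L (ne3ConstLayerOfRecord₁₁ F N (ℓ₃ F)).Nper (ne3ConstLayerOfRecord₁₁ F N (ℓ₃ F)).ε) F.L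
              (ne3ConstLayerOfRecord₁₁ F N (ℓ₃ F)).Nper j V UA →
            IsMinimiser 4 (sfClass 4 F.L (ne3ConstLayerOfRecord₁₁ F N (ℓ₃ F)).Nper (ne3ConstLayerOfRecord₁₁ F N (ℓ₃ F)).ε) F.L
              (ne3ConstLayerOfRecord₁₁ F N (ℓ₃ F)).Nper (j + 1) V UB →
            Regular 4 F.L (ne3ConstLayerOfRecord₁₁ F N (ℓ₃ F)).Nper (ne3ConstLayerOfRecord₁₁ F N (ℓ₃ F)).b (ne3ConstLayerOfRecord₁₁ F N (ℓ₃ F)).g (j + 1) UB →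
            RegularSup 4 F.L (ne3ConstLayerOfRecord₁₁ F N (ℓ₃ F)).Nper (ne3ConstLayerOfRecord₁₁ F N (ℓ₃ F)).b cg (j + 1) UB → i₀ < F.L → j₀ < F.L →
            ε' * ((F.L : ℝ)⁻¹) ^ (2 * j) ≤ t →
            |‖((hol UA z (plaqWord π.1.1 π.1.2) : (Matrix (Fin N) (Fin N) ℂ)ˣ) : Matrix (Fin N) (Fin N) ℂ) - 1‖
                - (F.L : ℝ) ^ 2 * ‖((hol UB ((F.L : ℤ) • z + boxVec F.L r₀ + (i₀ : ℤ) • e π.1.1 + (j₀ : ℤ) • e π.1.2)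
                    (plaqWord π.1.1 π.1.2) : (Matrix (Fin N) (Fin N) ℂ)ˣ) : Matrix (Fin N) (Fin N) ℂ) - 1‖| / t ≤ x) →
          ρB j ≤ x + τB j))
    (h14 : S_N14 (RRec₁₂ (readingOfRecord₁₂ w1 ℓ₃ ne2 ne1))) (h15 : S_N15 (RRec₁₂ (readingOfRecord₁₂ w1 ℓ₃ ne2 ne1)))
    (h16 : S_N16 (RRec₁₂ (readingOfRecord₁₂ w1 ℓ₃ ne2 ne1))) (h17 : S_N17 (RRec₁₂ (readingOfRecord₁₂ w1 ℓ₃ ne2 ne1)))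
    (h18 : S_N18 (RRec₁₂ (readingOfRecord₁₂ w1 ℓ₃ ne2 ne1))) (h22 : S_N22 (RRec₁₂ (readingOfRecord₁₂ w1 ℓ₃ ne2 ne1)))
    (hx' : S_N27x (fun F D w => IsRecordOfRecord₁₂C F N D w) (SRec₁₂ cr)) (h20 : S_N20 (SRec₁₂ cr))
    (h19 : ∀ (F : T4Family) (θ : Stage12Params F N) (hP : θ.Provisos₁₂ F N), θ.Admissible F N → ∀ (g₀ : ℕ → ℝ) (os : List (ULoop F))
      (h : IsDatumOfRecord₁₂C F N (datumOfRecord₁₂ F N θ hP)) (k : ℕ),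
      RatesAt (datumOfRecord₁₂ F N θ hP) (rateCarriersOfRecord₁₂ (readingOfRecord₁₂ w1 ℓ₃ ne2 ne1) F h.params h.provisos g₀ os k) →
        letI := (cr F θ hP g₀ os).dec
        ∃ δ : ℕ → ℝ, NE7.Core (cr F θ hP g₀ os).l₀ (cr F θ hP g₀ os).vol (cr F θ hP g₀ os).T (cr F θ hP g₀ os).Bad
          (fun K t τ => (cr F θ hP g₀ os).A K t τ - (cr F θ hP g₀ os).shA K t τ) (fun K t τ => (cr F θ hP g₀ os).B K t τ - (cr F θ hP g₀ os).shB K t τ) δ ∧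
          Summable δ) :
    Spine (N := N) fun F D w => IsRecordOfRecord₁₂C F N D w :=
  spine_rec12C_of_homes₁₂_constLayer cr (readingOfRecord₁₂ w1 ℓ₃ ne2 ne1) (fun F => ne3ConstLayerOfRecord₁₁ F N (ℓ₃ F)) (fun _ _ _ _ _ _ => rfl) h16 hreg hnum
    hread h14 h15 h17 h18 h22 hx' h20 h19

variable (g Λ : T4Family → ℝ) (hg : ∀ F, 0 < g F) (hΛ : ∀ F, 0 < Λ F)
  (hread : ∀ (F : T4Family) (θ : Stage12Params F N) (hP : θ.Provisos₁₂ F N), θ.Admissible F N → ∀ (g₀ : ℕ → ℝ) (os : List (ULoop F)),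
    ∃ (ε' cg : ℝ) (σA σB : Type) (SA : ℕ → Finset σA) (SB : ℕ → Finset σB) (pieceA : ℕ → ℝ → σA → (cr F θ hP g₀ os).ι → ℝ)
      (pieceB : ℕ → ℝ → σB → (cr F θ hP g₀ os).ι → ℝ) (lvlA : ℕ → σA → ℕ) (lvlB : ℕ → σB → ℕ) (DA ρA DB ρB τA τB : ℕ → ℝ) (N₁ : ℕ)
      (νbar Dbar c₂ ϑ₂ : ℝ),
      0 < ε' ∧ 0 ≤ cg ∧
      LevelLedger (cr F θ hP g₀ os).l₀ (cr F θ hP g₀ os).T (cr F θ hP g₀ os).A (cr F θ hP g₀ os).shA SA pieceA lvlA DA ρA ∧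
      LevelLedger (cr F θ hP g₀ os).l₀ (cr F θ hP g₀ os).T (cr F θ hP g₀ os).B (cr F θ hP g₀ os).shB SB pieceB lvlB DB ρB ∧
      LiveWindow SA lvlA N₁ νbar ∧ LiveWindow SB lvlB N₁ νbar ∧ (∀ j, DA j ≤ Dbar) ∧ (∀ j, DB j ≤ Dbar) ∧
      0 ≤ c₂ ∧ 0 ≤ ϑ₂ ∧ ϑ₂ < 1 ∧ (∀ j, τA j ≤ c₂ * ϑ₂ ^ j) ∧ (∀ j, τB j ≤ c₂ * ϑ₂ ^ j) ∧
      (∀ j, 1 ≤ j → ∀ x : ℝ,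
        (∀ (V UA UB : B7Prop1Explicit.Site 4 → Fin 4 → (Matrix (Fin N) (Fin N) ℂ)ˣ) (z : B7Prop1Explicit.Site 4) (μ ν : Fin 4) (t : ℝ),
          V ∈ (ne3ConstLayerOfRecord₁₁ F N (endLettersN21 F N (g F) (Λ F))).dom →
          IsMinimiser 4 (sfClass 4 F.L (ne3ConstLayerOfRecord₁₁ F N (endLettersN21 F N (g F) (Λ F))).Nper
            (ne3ConstLayerOfRecord₁₁ F N (endLettersN21 F N (g F) (Λ F))).ε) F.L (ne3ConstLayerOfRecord₁₁ F N (endLettersN21 F N (g F) (Λ F))).Nper j V UA →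
          IsMinimiser 4 (sfClass 4 F.L (ne3ConstLayerOfRecord₁₁ F N (endLettersN21 F N (g F) (Λ F))).Nper
            (ne3ConstLayerOfRecord₁₁ F N (endLettersN21 F N (g F) (Λ F))).ε) F.L (ne3ConstLayerOfRecord₁₁ F N (endLettersN21 F N (g F) (Λ F))).Nper (j + 1) V UB →
          Regular 4 F.L (ne3ConstLayerOfRecord₁₁ F N (endLettersN21 F N (g F) (Λ F))).Nper (ne3ConstLayerOfRecord₁₁ F N (endLettersN21 F N (g F) (Λ F))).b
            (ne3ConstLayerOfRecord₁₁ F N (endLettersN21 F N (g F) (Λ F))).g (j + 1) UB →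
          ε' * ((F.L : ℝ)⁻¹) ^ (2 * j) ≤ t →
          |‖((hol UA z (plaqWord μ ν) : (Matrix (Fin N) (Fin N) ℂ)ˣ) : Matrix (Fin N) (Fin N) ℂ) - 1‖
              - ‖((hol (rescale F.L (bavg F.L UB)) z (plaqWord μ ν) : (Matrix (Fin N) (Fin N) ℂ)ˣ) : Matrix (Fin N) (Fin N) ℂ) - 1‖| / t ≤ x) →
        ρA j ≤ x + τA j) ∧
      (∀ j, 1 ≤ j → ∀ x : ℝ,
        (∀ (V UA UB : B7Prop1Explicit.Site 4 → Fin 4 → (Matrix (Fin N) (Fin N) ℂ)ˣ) (z : B7Prop1Explicit.Site 4) (π : Plane 4)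
          (r₀ : Fin 4 → Fin F.L) (i₀ j₀ : ℕ) (t : ℝ),
          V ∈ (ne3ConstLayerOfRecord₁₁ F N (endLettersN21 F N (g F) (Λ F))).dom →
          IsMinimiser 4 (sfClass 4 F.L (ne3ConstLayerOfRecord₁₁ F N (endLettersN21 F N (g F) (Λ F))).Nper
            (ne3ConstLayerOfRecord₁₁ F N (endLettersN21 F N (g F) (Λ F))).ε) F.L (ne3ConstLayerOfRecord₁₁ F N (endLettersN21 F N (g F) (Λ F))).Nper j V UA →
          IsMinimiser 4 (sfClass 4 F.L (ne3ConstLayerOfRecord₁₁ F N (endLettersN21 F N (g F) (Λ F))).Nper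
            (ne3ConstLayerOfRecord₁₁ F N (endLettersN21 F N (g F) (Λ F))).ε) F.L (ne3ConstLayerOfRecord₁₁ F N (endLettersN21 F N (g F) (Λ F))).Nper (j + 1) V UB →
          Regular 4 F.L (ne3ConstLayerOfRecord₁₁ F N (endLettersN21 F N (g F) (Λ F))).Nper (ne3ConstLayerOfRecord₁₁ F N (endLettersN21 F N (g F) (Λ F))).b
            (ne3ConstLayerOfRecord₁₁ F N (endLettersN21 F N (g F) (Λ F))).g (j + 1) UB →
          RegularSup 4 F.L (ne3ConstLayerOfRecord₁₁ F N (endLettersN21 F N (g F) (Λ F))).Nper (ne3ConstLayerOfRecord₁₁ F N (endLettersN21 F N (g F) (Λ F))).b cg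
            (j + 1) UB → i₀ < F.L → j₀ < F.L → ε' * ((F.L : ℝ)⁻¹) ^ (2 * j) ≤ t →
          |‖((hol UA z (plaqWord π.1.1 π.1.2) : (Matrix (Fin N) (Fin N) ℂ)ˣ) : Matrix (Fin N) (Fin N) ℂ) - 1‖
              - (F.L : ℝ) ^ 2 * ‖((hol UB ((F.L : ℤ) • z + boxVec F.L r₀ + (i₀ : ℤ) • e π.1.1 + (j₀ : ℤ) • e π.1.2)
                  (plaqWord π.1.1 π.1.2) : (Matrix (Fin N) (Fin N) ℂ)ˣ) : Matrix (Fin N) (Fin N) ℂ) - 1‖| / t ≤ x) →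
        ρB j ≤ x + τB j))
  (h14 : S_N14 (RRec₁₂ (readingOfRecord₁₂ w1 (fun F => endLettersN21 F N (g F) (Λ F)) ne2 ne1)))
  (h15 : S_N15 (RRec₁₂ (readingOfRecord₁₂ w1 (fun F => endLettersN21 F N (g F) (Λ F)) ne2 ne1)))
  (h17 : S_N17 (RRec₁₂ (readingOfRecord₁₂ w1 (fun F => endLettersN21 F N (g F) (Λ F)) ne2 ne1)))
  (h18 : S_N18 (RRec₁₂ (readingOfRecord₁₂ w1 (fun F => endLettersN21 F N (g F) (Λ F)) ne2 ne1)))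
  (h22 : S_N22 (RRec₁₂ (readingOfRecord₁₂ w1 (fun F => endLettersN21 F N (g F) (Λ F)) ne2 ne1)))
  (hx' : S_N27x (fun F D w => IsRecordOfRecord₁₂C F N D w) (SRec₁₂ cr)) (h20 : S_N20 (SRec₁₂ cr))
  (h19 : ∀ (F : T4Family) (θ : Stage12Params F N) (hP : θ.Provisos₁₂ F N), θ.Admissible F N → ∀ (g₀ : ℕ → ℝ) (os : List (ULoop F))
    (h : IsDatumOfRecord₁₂C F N (datumOfRecord₁₂ F N θ hP)) (k : ℕ),
    RatesAt (datumOfRecord₁₂ F N θ hP)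
        (rateCarriersOfRecord₁₂ (readingOfRecord₁₂ w1 (fun F => endLettersN21 F N (g F) (Λ F)) ne2 ne1) F h.params h.provisos g₀ os k) →
      letI := (cr F θ hP g₀ os).dec
      ∃ δ : ℕ → ℝ, NE7.Core (cr F θ hP g₀ os).l₀ (cr F θ hP g₀ os).vol (cr F θ hP g₀ os).T (cr F θ hP g₀ os).Bad
        (fun K t τ => (cr F θ hP g₀ os).A K t τ - (cr F θ hP g₀ os).shA K t τ) (fun K t τ => (cr F θ hP g₀ os).B K t τ - (cr F θ hP g₀ os).shB K t τ) δ ∧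
        Summable δ)

include hg hΛ hread h14 h15 h17 h18 h22 hx' h20 h19

/-- **THE COMPOSITE AT THE READING OF RECORD WITH TUNED LETTERS — THE N21 SLOT COSTS ONLY NODE O's TERM-OBJECT READINGS.**  As `spine_rec12C_of_homes₁₂_readingOfRecord₁₂` at
`ℓ₃ F := endLettersN21 F N (g F) (Λ F)` (`0 < g F`, `0 < Λ F`): THE END's proviso and N21's numerals at RR-1's object of every family are module 11a's, so besides the composite's
own stubs (`h14 … h22` AT THE READING OF RECORD, `S_N27x`, `S_N20`, the edge `h19`) the N21 slot asks ONLY `hread`.  Conclusion `Spine ₁₂C`.  Every binder a HYPOTHESIS; N21 ∕ N27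
NOT discharged; K3′ NOT claimed. [bookkeeping] -/
theorem spine_rec12C_of_homes₁₂_readingOfRecord₁₂_tuned (h16 : S_N16 (RRec₁₂ (readingOfRecord₁₂ w1 (fun F => endLettersN21 F N (g F) (Λ F)) ne2 ne1))) :
    Spine (N := N) fun F D w => IsRecordOfRecord₁₂C F N D w :=
  spine_rec12C_of_homes₁₂_readingOfRecord₁₂ w1 ne2 ne1 cr (fun F => endLettersN21 F N (g F) (Λ F))
    (fun F => inEndRegime_ofRecord_endLettersN21 F N (Λ F) (hg F)) (fun F => ⟨numeral_endLettersN21 F N (g F) (Λ F), hΛ F⟩) hread h14 h15 h16 h17 h18 h22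
    hx' h20 h19

/-- **THE SAME WITH THE N16 SLOT SUPPLIED BY dag-n16-e's CLOSER FROM `LeafSlot` AT THE TUNED OBJECT OF RECORD** (`s_N16_rRec₁₂_ofRecord_of_leafSlot` BY NAME, its proviso module
11a's): in K3′'s composite at the Stage-12 homes read at the reading of record with tuned letters, N16 ↦ `LeafSlot` at `ne3ConstLayerOfRecord₁₁ F N (endLettersN21 …)` for every
family carrying a datum of record (N05's typed leaf clauses ∘ N07's `LeafH3sup` — HYPOTHESIS), N21 ↦ `hread`; the other stubs and the edge as displayed.  Conclusion `Spine ₁₂C`.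
N16 ∕ N21 ∕ N27 NOT discharged; K3′ NOT claimed. [bookkeeping] -/
theorem spine_rec12C_of_homes₁₂_readingOfRecord₁₂_tuned_of_leafSlot
    (hslot : ∀ (F : T4Family), (∃ D : Datum F N, IsDatumOfRecord₁₂C F N D) →
      LeafSlot (ne3OfRecord₁₁ F (ne3ConstLayerOfRecord₁₁ F N (endLettersN21 F N (g F) (Λ F))))) :
    Spine (N := N) fun F D w => IsRecordOfRecord₁₂C F N D w :=
  spine_rec12C_of_homes₁₂_readingOfRecord₁₂_tuned w1 ne2 ne1 cr g Λ hg hΛ hread h14 h15 h17 h18 h22 hx' h20 h19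
    (s_N16_rRec₁₂_ofRecord_of_leafSlot (readingOfRecord₁₂ w1 (fun F => endLettersN21 F N (g F) (Λ F)) ne2 ne1) (fun F => endLettersN21 F N (g F) (Λ F))
      (fun _ _ _ _ _ _ => rfl) fun F hF => ⟨inEndRegime_ofRecord_endLettersN21 F N (Λ F) (hg F), hslot F hF⟩)

end Composite

/-! ## v1.1 §4 — The composite at WINDOWED letters `endLettersN21W F N (g F) (ε F) (Λ₁ F) (Λ F)` (n16-e LOCATED-3's repair on N21's side) -/

section Window

open Summit.QuantumFields.YangMills.BalabanUVNodes.N16Regime (radiusOfRecord)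
open Node00 (ne3NperOfRecord₁₁)

variable (cr : SpineReading₁₂ N) (g ε Λ₁ Λ : T4Family → ℝ) (hg : ∀ F, 0 < g F)
  (hε : ∀ F, 0 < ε F ∧ ε F ≤ radiusOfRecord N F.L (ne3NperOfRecord₁₁ F 0 0))
  (hΛ₁ : ∀ F, 0 ≤ Λ₁ F ∧ Λ₁ F ≤ radiusOfRecord N F.L (ne3NperOfRecord₁₁ F 0 0)) (hΛ : ∀ F, 0 < Λ F)
  (hread : ∀ (F : T4Family) (θ : Stage12Params F N) (hP : θ.Provisos₁₂ F N), θ.Admissible F N → ∀ (g₀ : ℕ → ℝ) (os : List (ULoop F)),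
    ∃ (ε' cg : ℝ) (σA σB : Type) (SA : ℕ → Finset σA) (SB : ℕ → Finset σB) (pieceA : ℕ → ℝ → σA → (cr F θ hP g₀ os).ι → ℝ)
      (pieceB : ℕ → ℝ → σB → (cr F θ hP g₀ os).ι → ℝ) (lvlA : ℕ → σA → ℕ) (lvlB : ℕ → σB → ℕ) (DA ρA DB ρB τA τB : ℕ → ℝ) (N₁ : ℕ)
      (νbar Dbar c₂ ϑ₂ : ℝ),
      0 < ε' ∧ 0 ≤ cg ∧
      LevelLedger (cr F θ hP g₀ os).l₀ (cr F θ hP g₀ os).T (cr F θ hP g₀ os).A (cr F θ hP g₀ os).shA SA pieceA lvlA DA ρA ∧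
      LevelLedger (cr F θ hP g₀ os).l₀ (cr F θ hP g₀ os).T (cr F θ hP g₀ os).B (cr F θ hP g₀ os).shB SB pieceB lvlB DB ρB ∧
      LiveWindow SA lvlA N₁ νbar ∧ LiveWindow SB lvlB N₁ νbar ∧ (∀ j, DA j ≤ Dbar) ∧ (∀ j, DB j ≤ Dbar) ∧
      0 ≤ c₂ ∧ 0 ≤ ϑ₂ ∧ ϑ₂ < 1 ∧ (∀ j, τA j ≤ c₂ * ϑ₂ ^ j) ∧ (∀ j, τB j ≤ c₂ * ϑ₂ ^ j) ∧
      (∀ j, 1 ≤ j → ∀ x : ℝ,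
        (∀ (V UA UB : B7Prop1Explicit.Site 4 → Fin 4 → (Matrix (Fin N) (Fin N) ℂ)ˣ) (z : B7Prop1Explicit.Site 4) (μ ν : Fin 4) (t : ℝ),
          V ∈ (ne3ConstLayerOfRecord₁₁ F N (endLettersN21W F N (g F) (ε F) (Λ₁ F) (Λ F))).dom →
          IsMinimiser 4 (sfClass 4 F.L (ne3ConstLayerOfRecord₁₁ F N (endLettersN21W F N (g F) (ε F) (Λ₁ F) (Λ F))).Nper
            (ne3ConstLayerOfRecord₁₁ F N (endLettersN21W F N (g F) (ε F) (Λ₁ F) (Λ F))).ε) F.L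
            (ne3ConstLayerOfRecord₁₁ F N (endLettersN21W F N (g F) (ε F) (Λ₁ F) (Λ F))).Nper j V UA →
          IsMinimiser 4 (sfClass 4 F.L (ne3ConstLayerOfRecord₁₁ F N (endLettersN21W F N (g F) (ε F) (Λ₁ F) (Λ F))).Nper
            (ne3ConstLayerOfRecord₁₁ F N (endLettersN21W F N (g F) (ε F) (Λ₁ F) (Λ F))).ε) F.L
            (ne3ConstLayerOfRecord₁₁ F N (endLettersN21W F N (g F) (ε F) (Λ₁ F) (Λ F))).Nper (j + 1) V UB →
          Regular 4 F.L (ne3ConstLayerOfRecord₁₁ F N (endLettersN21W F N (g F) (ε F) (Λ₁ F) (Λ F))).Nper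
            (ne3ConstLayerOfRecord₁₁ F N (endLettersN21W F N (g F) (ε F) (Λ₁ F) (Λ F))).b
            (ne3ConstLayerOfRecord₁₁ F N (endLettersN21W F N (g F) (ε F) (Λ₁ F) (Λ F))).g (j + 1) UB →
          ε' * ((F.L : ℝ)⁻¹) ^ (2 * j) ≤ t →
          |‖((hol UA z (plaqWord μ ν) : (Matrix (Fin N) (Fin N) ℂ)ˣ) : Matrix (Fin N) (Fin N) ℂ) - 1‖
              - ‖((hol (rescale F.L (bavg F.L UB)) z (plaqWord μ ν) : (Matrix (Fin N) (Fin N) ℂ)ˣ) : Matrix (Fin N) (Fin N) ℂ) - 1‖| / t ≤ x) →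
        ρA j ≤ x + τA j) ∧
      (∀ j, 1 ≤ j → ∀ x : ℝ,
        (∀ (V UA UB : B7Prop1Explicit.Site 4 → Fin 4 → (Matrix (Fin N) (Fin N) ℂ)ˣ) (z : B7Prop1Explicit.Site 4) (π : Plane 4)
          (r₀ : Fin 4 → Fin F.L) (i₀ j₀ : ℕ) (t : ℝ),
          V ∈ (ne3ConstLayerOfRecord₁₁ F N (endLettersN21W F N (g F) (ε F) (Λ₁ F) (Λ F))).dom →
          IsMinimiser 4 (sfClass 4 F.L (ne3ConstLayerOfRecord₁₁ F N (endLettersN21W F N (g F) (ε F) (Λ₁ F) (Λ F))).Nper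
            (ne3ConstLayerOfRecord₁₁ F N (endLettersN21W F N (g F) (ε F) (Λ₁ F) (Λ F))).ε) F.L
            (ne3ConstLayerOfRecord₁₁ F N (endLettersN21W F N (g F) (ε F) (Λ₁ F) (Λ F))).Nper j V UA →
          IsMinimiser 4 (sfClass 4 F.L (ne3ConstLayerOfRecord₁₁ F N (endLettersN21W F N (g F) (ε F) (Λ₁ F) (Λ F))).Nper
            (ne3ConstLayerOfRecord₁₁ F N (endLettersN21W F N (g F) (ε F) (Λ₁ F) (Λ F))).ε) F.L
            (ne3ConstLayerOfRecord₁₁ F N (endLettersN21W F N (g F) (ε F) (Λ₁ F) (Λ F))).Nper (j + 1) V UB →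
          Regular 4 F.L (ne3ConstLayerOfRecord₁₁ F N (endLettersN21W F N (g F) (ε F) (Λ₁ F) (Λ F))).Nper
            (ne3ConstLayerOfRecord₁₁ F N (endLettersN21W F N (g F) (ε F) (Λ₁ F) (Λ F))).b
            (ne3ConstLayerOfRecord₁₁ F N (endLettersN21W F N (g F) (ε F) (Λ₁ F) (Λ F))).g (j + 1) UB →
          RegularSup 4 F.L (ne3ConstLayerOfRecord₁₁ F N (endLettersN21W F N (g F) (ε F) (Λ₁ F) (Λ F))).Nper
            (ne3ConstLayerOfRecord₁₁ F N (endLettersN21W F N (g F) (ε F) (Λ₁ F) (Λ F))).b cg (j + 1) UB → i₀ < F.L → j₀ < F.L →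
          ε' * ((F.L : ℝ)⁻¹) ^ (2 * j) ≤ t →
          |‖((hol UA z (plaqWord π.1.1 π.1.2) : (Matrix (Fin N) (Fin N) ℂ)ˣ) : Matrix (Fin N) (Fin N) ℂ) - 1‖
              - (F.L : ℝ) ^ 2 * ‖((hol UB ((F.L : ℤ) • z + boxVec F.L r₀ + (i₀ : ℤ) • e π.1.1 + (j₀ : ℤ) • e π.1.2)
                  (plaqWord π.1.1 π.1.2) : (Matrix (Fin N) (Fin N) ℂ)ˣ) : Matrix (Fin N) (Fin N) ℂ) - 1‖| / t ≤ x) →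
        ρB j ≤ x + τB j))
  (h14 : S_N14 (RRec₁₂ (readingOfRecord₁₂ w1 (fun F => endLettersN21W F N (g F) (ε F) (Λ₁ F) (Λ F)) ne2 ne1)))
  (h15 : S_N15 (RRec₁₂ (readingOfRecord₁₂ w1 (fun F => endLettersN21W F N (g F) (ε F) (Λ₁ F) (Λ F)) ne2 ne1)))
  (h17 : S_N17 (RRec₁₂ (readingOfRecord₁₂ w1 (fun F => endLettersN21W F N (g F) (ε F) (Λ₁ F) (Λ F)) ne2 ne1)))
  (h18 : S_N18 (RRec₁₂ (readingOfRecord₁₂ w1 (fun F => endLettersN21W F N (g F) (ε F) (Λ₁ F) (Λ F)) ne2 ne1)))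
  (h22 : S_N22 (RRec₁₂ (readingOfRecord₁₂ w1 (fun F => endLettersN21W F N (g F) (ε F) (Λ₁ F) (Λ F)) ne2 ne1)))
  (hx' : S_N27x (fun F D w => IsRecordOfRecord₁₂C F N D w) (SRec₁₂ cr)) (h20 : S_N20 (SRec₁₂ cr))
  (h19 : ∀ (F : T4Family) (θ : Stage12Params F N) (hP : θ.Provisos₁₂ F N), θ.Admissible F N → ∀ (g₀ : ℕ → ℝ) (os : List (ULoop F))
    (h : IsDatumOfRecord₁₂C F N (datumOfRecord₁₂ F N θ hP)) (k : ℕ),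
    RatesAt (datumOfRecord₁₂ F N θ hP)
        (rateCarriersOfRecord₁₂ (readingOfRecord₁₂ w1 (fun F => endLettersN21W F N (g F) (ε F) (Λ₁ F) (Λ F)) ne2 ne1) F h.params h.provisos g₀ os k) →
      letI := (cr F θ hP g₀ os).dec
      ∃ δ : ℕ → ℝ, NE7.Core (cr F θ hP g₀ os).l₀ (cr F θ hP g₀ os).vol (cr F θ hP g₀ os).T (cr F θ hP g₀ os).Bad
        (fun K t τ => (cr F θ hP g₀ os).A K t τ - (cr F θ hP g₀ os).shA K t τ) (fun K t τ => (cr F θ hP g₀ os).B K t τ - (cr F θ hP g₀ os).shB K t τ) δ ∧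
        Summable δ)

include hg hε hΛ₁ hΛ hread h14 h15 h17 h18 h22 hx' h20 h19

/-- **THE COMPOSITE AT THE READING OF RECORD WITH WINDOWED LETTERS — THE N21 SLOT COSTS ONLY NODE O's TERM-OBJECT READINGS.**  §1's
`spine_rec12C_of_homes₁₂_readingOfRecord₁₂` at `ℓ₃ F := endLettersN21W F N (g F) (ε F) (Λ₁ F) (Λ F)` with the letter lines DISPLAYED (`0 < g F`, `0 < ε F ≤ r_F`, `0 ≤ Λ₁ F ≤ r_F`,
`0 < Λ F`): THE END's proviso and N21's numerals at RR-1's windowed object of every family are module 11a v1.1's (`inEndRegime_ofRecord_endLettersN21W`, `numeral_endLettersN21W`),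
so besides the composite's own stubs (`h14 … h22` AT THE WINDOWED READING, `S_N27x`, `S_N20`, the edge `h19`) the N21 slot asks ONLY `hread`.  Conclusion `Spine ₁₂C`.  Every binder
a HYPOTHESIS; N21 ∕ N27 NOT discharged; K3′ NOT claimed. [bookkeeping] -/
theorem spine_rec12C_of_homes₁₂_readingOfRecord₁₂_window
    (h16 : S_N16 (RRec₁₂ (readingOfRecord₁₂ w1 (fun F => endLettersN21W F N (g F) (ε F) (Λ₁ F) (Λ F)) ne2 ne1))) :
    Spine (N := N) fun F D w => IsRecordOfRecord₁₂C F N D w :=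
  spine_rec12C_of_homes₁₂_readingOfRecord₁₂ w1 ne2 ne1 cr (fun F => endLettersN21W F N (g F) (ε F) (Λ₁ F) (Λ F))
    (fun F => inEndRegime_ofRecord_endLettersN21W F N (Λ F) (hg F) (hε F).1 (hε F).2 (hΛ₁ F).1 (hΛ₁ F).2)
    (fun F => ⟨numeral_endLettersN21W F N (g F) (ε F) (Λ₁ F) (Λ F), hΛ F⟩) hread h14 h15 h16 h17 h18 h22 hx' h20 h19

/-- **THE SAME WITH THE N16 SLOT SUPPLIED FROM `LeafSlot` AT THE WINDOWED OBJECT OF RECORD** (dag-n16-e's `s_N16_rRec₁₂_ofRecord_of_leafSlot` BY NAME, its proviso module 11a v1.1's):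
N16 ↦ `LeafSlot` at `ne3ConstLayerOfRecord₁₁ F N (endLettersN21W …)` for every family carrying a datum of record — at letters the caller may take INSIDE node N05's averaging window,
where dag-n16-e's recipe `…N16SlotWindow.leafSlot_ofRecord_of_window` supplies it from N05's typed leaf clauses ∘ N07's `LeafH3sup` (HYPOTHESES there) —, N21 ↦ `hread`; the other stubs and
the edge as displayed.  Conclusion `Spine ₁₂C`.  N16 ∕ N21 ∕ N27 NOT discharged; K3′ NOT claimed. [bookkeeping] -/
theorem spine_rec12C_of_homes₁₂_readingOfRecord₁₂_window_of_leafSlot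
    (hslot : ∀ (F : T4Family), (∃ D : Datum F N, IsDatumOfRecord₁₂C F N D) →
      LeafSlot (ne3OfRecord₁₁ F (ne3ConstLayerOfRecord₁₁ F N (endLettersN21W F N (g F) (ε F) (Λ₁ F) (Λ F))))) :
    Spine (N := N) fun F D w => IsRecordOfRecord₁₂C F N D w :=
  spine_rec12C_of_homes₁₂_readingOfRecord₁₂_window w1 ne2 ne1 cr g ε Λ₁ Λ hg hε hΛ₁ hΛ hread h14 h15 h17 h18 h22 hx' h20 h19
    (s_N16_rRec₁₂_ofRecord_of_leafSlot (readingOfRecord₁₂ w1 (fun F => endLettersN21W F N (g F) (ε F) (Λ₁ F) (Λ F)) ne2 ne1)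
      (fun F => endLettersN21W F N (g F) (ε F) (Λ₁ F) (Λ F)) (fun _ _ _ _ _ _ => rfl)
      fun F hF => ⟨inEndRegime_ofRecord_endLettersN21W F N (Λ F) (hg F) (hε F).1 (hε F).2 (hΛ₁ F).1 (hΛ₁ F).2, hslot F hF⟩)

end Window

end Summit.QuantumFields.YangMills.Theorems.N21AtReadingOfRecord12

end
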